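import Summits.CriticalPhenomena.PercolationContinuityZ3.Theorems.PercNearOneGluingNoHeavyLowerTailSahiCombTriWGenU

/-!
# The SYMMETRIC MASTER FORM (SYM) of the triangle functional: three up-sets, three arbitrary TRANSLATES, and the reduction
# `TranslateIneq → TriWGenIneq → TriWIneq`

Support file of the one-cut programme (crux `NoHeavyLowerTail`, stmt-CriticalPhenomena-4575; cell `prim-masterthm`, seat P5 gen 18;
memo `FROM-prim-masterthm-p5-g18-SYMMETRIC-MASTER-FORM.md` §3).

On the cube `Ω = Z₂^M` write `σ` for complementation and `S + a = {ω ∆ a | ω ∈ S}` for the translate of a family by `a ∈ Ω`.  The conjecture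
(SYM) of the memo says that for ANY three up-sets `𝒰, 𝔽, 𝔾 ⊆ Ω` and ANY three translates `a, b, c`:

  `#((𝒰+a) ∩ (𝔽+b) ∩ (𝔾+c)) + 2·#(𝒰 ∩ 𝔽 ∩ 𝔾) ≥ #(σ𝒰 ∩ 𝔽 ∩ 𝔾) + #(𝒰 ∩ σ𝔽 ∩ 𝔾) + #(𝒰 ∩ 𝔽 ∩ σ𝔾)`,

i.e. the number of triple points destroyed by translating the three up-sets arbitrarily never exceeds the sum of the three Kleitman gaps
`#(𝒰𝔽𝔾) − #(σ𝒰 ∩ 𝔽𝔾)` etc.  It is symmetric in the three sets and translation-invariant; `a = b = c` is three Kleitman lemmas, two equal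
translates reduce to the translate lemma `#(S ∩ (𝒳+t)) ≥ #(S ∩ σ𝒳)`; coordinates flipped in none or all of `a,b,c` peel off by induction
(memo §3.2), so the content is the "3-block core" (each coordinate flipped in exactly one of the three sets).  CENSUS (gen 18, exact C,
kit j141304/j141305 on stmt-4575): EXHAUSTIVE over all `(𝒰,𝔽,𝔾,b,c)` (with `a = 0`) on `Z₂^m`, `m ≤ 5` — at `m = 5` that is
`7581³ × 1024 ≈ 4.5·10¹⁴` configurations — 0 violations, 6.5·10⁷ tight configurations (1.55·10⁷ of them in the 3-block core); sampled `m = 6`.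
Here the conjecture is typed in the tree's TWO-CUBE family language (`Ω = Finset β × Finset γ`, a family `U : Finset β → Finset (Finset γ)`
is the up-set `{(x,w) | w ∈ U x}`, a translate is a pair `(a₁ ⊆ β, a₂ ⊆ γ)`), which makes the reduction to `TriWGenIneq` a specialisation:

* `FiveUpSet.transl a 𝒜 = {s ∆ a | s ∈ 𝒜}` — translate of a family of subsets (`mem_transl`, `transl_empty`, `transl_univ = refl`);
* `FiveUpSet.translTerm`, the configuration count `Σ_x #(transl a₂ (U (x ∆ a₁)) ∩ transl b₂ (F (x ∆ b₁)) ∩ transl c₂ (G (x ∆ c₁)))`;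
* **`FiveUpSet.TranslateIneq`** (`@[conjecture]`, an obligation of our theory, never a fact) — (SYM) for monotone families of up-sets;
* **`FiveUpSet.triWGenIneq_of_translateIneq : TranslateIneq → TriWGenIneq`** — `triWGen` is (SYM) at the translates
  `a = (∅,∅)`, `b = (univ,univ)`, `c = (univ,∅)`; hence **`FiveUpSet.triWIneq_of_translateIneq : TranslateIneq → TriWIneq`**.
HONEST LABEL: a definition, a typed conjecture (census-clean, NOT proved) and its reduction to the crux target; nothing here proves
`TriWIneq`. [this work]
-/

namespace Summit.CriticalPhenomena.PercolationContinuityZ3.Theorems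

namespace FiveUpSet

open Finset
open scoped symmDiff

variable {β γ : Type} [DecidableEq β] [Fintype β] [DecidableEq γ] [Fintype γ]

/-! ### Translates of a family of subsets -/

/-- The translate of a family of subsets of `γ` by `a ⊆ γ` (in the group `Z₂^γ`): `transl a 𝒜 = {s ∆ a | s ∈ 𝒜}`. [this work] -/
def transl (a : Finset γ) (𝒜 : Finset (Finset γ)) : Finset (Finset γ) :=
  𝒜.map ⟨fun s => s ∆ a, symmDiff_left_injective a⟩

omit [Fintype γ] in
/-- Membership in a translate: `s ∈ transl a 𝒜 ↔ s ∆ a ∈ 𝒜`. [this work] -/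
theorem mem_transl {a : Finset γ} {𝒜 : Finset (Finset γ)} {s : Finset γ} : s ∈ transl a 𝒜 ↔ s ∆ a ∈ 𝒜 := by
  unfold transl
  rw [mem_map]
  constructor
  · rintro ⟨t, ht, rfl⟩
    simpa [symmDiff_symmDiff_cancel_right] using ht
  · intro h
    exact ⟨s ∆ a, h, by simp [symmDiff_symmDiff_cancel_right]⟩

/-- `s ∆ ∅ = s` for finsets. [folklore] -/
theorem symmDiff_empty_right {δ : Type} [DecidableEq δ] (s : Finset δ) : s ∆ (∅ : Finset δ) = s := by
  ext i
  simp [mem_symmDiff]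

/-- `s ∆ univ = sᶜ` in a finite cube. [folklore] -/
theorem symmDiff_univ_eq_compl {δ : Type} [DecidableEq δ] [Fintype δ] (s : Finset δ) : s ∆ (univ : Finset δ) = sᶜ := by
  ext i
  simp [mem_symmDiff]

omit [Fintype γ] in
/-- Translating by `∅` does nothing. [this work] -/
theorem transl_empty (𝒜 : Finset (Finset γ)) : transl ∅ 𝒜 = 𝒜 := by
  ext s
  rw [mem_transl, symmDiff_empty_right]

/-- Translating by `univ` is the antipodal map: `transl univ 𝒜 = refl 𝒜`. [this work] -/
theorem transl_univ (𝒜 : Finset (Finset γ)) : transl univ 𝒜 = refl 𝒜 := by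
  ext s
  rw [mem_transl, mem_refl, symmDiff_univ_eq_compl]

/-! ### The symmetric master conjecture (SYM), two-cube family form -/

/-- The translate-configuration count of three families (memo §3, `Φ(a,b,c)`): with translates `a = (a₁,a₂)`, `b = (b₁,b₂)`, `c = (c₁,c₂)`
of the product cube `Finset β × Finset γ`,
`translTerm U F G a₁ a₂ b₁ b₂ c₁ c₂ = Σ_x #(transl a₂ (U (x ∆ a₁)) ∩ transl b₂ (F (x ∆ b₁)) ∩ transl c₂ (G (x ∆ c₁)))`
= the number of points `(x,w)` with `(x ∆ a₁, w ∆ a₂) ∈ 𝒰`, `(x ∆ b₁, w ∆ b₂) ∈ 𝔽`, `(x ∆ c₁, w ∆ c₂) ∈ 𝔾`. [this work] -/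
def translTerm (U F G : Finset β → Finset (Finset γ)) (a₁ : Finset β) (a₂ : Finset γ) (b₁ : Finset β) (b₂ : Finset γ)
    (c₁ : Finset β) (c₂ : Finset γ) : ℕ :=
  ∑ x : Finset β, (transl a₂ (U (x ∆ a₁)) ∩ transl b₂ (F (x ∆ b₁)) ∩ transl c₂ (G (x ∆ c₁))).card

/-- **(SYM) — the symmetric master form of the triangle functional** (CONJECTURE — an obligation of our theory, never a fact; memo §3).
For finite cubes `Finset β`, `Finset γ`, three MONOTONE families `U F G : Finset β → Finset (Finset γ)` of up-sets (= three up-sets of the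
product cube) and ANY three translates:
`Σ_x [#(refl (U xᶜ) ∩ F x ∩ G x) + #(U x ∩ refl (F xᶜ) ∩ G x) + #(U x ∩ F x ∩ refl (G xᶜ))] ≤ translTerm U F G a₁ a₂ b₁ b₂ c₁ c₂ + 2·Σ_x #(U x ∩ F x ∩ G x)`.
Census: exhaustive on `Z₂^m`, `m ≤ 5` (all up-set triples, all translates; 4.5e14 configurations at `m = 5`), sampled `m = 6`: 0 violations,
tight.  Special translates give `TriWGenIneq` (`triWGenIneq_of_translateIneq`) and hence `TriWIneq`. OPEN. [this work] -/
@[conjecture] def TranslateIneq : Prop :=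
  ∀ (β γ : Type) [DecidableEq β] [Fintype β] [DecidableEq γ] [Fintype γ]
    (U F G : Finset β → Finset (Finset γ)),
    (∀ x, IsUpperSet (U x : Set (Finset γ))) → (∀ x, IsUpperSet (F x : Set (Finset γ))) → (∀ x, IsUpperSet (G x : Set (Finset γ))) →
    Monotone U → Monotone F → Monotone G →
    ∀ (a₁ : Finset β) (a₂ : Finset γ) (b₁ : Finset β) (b₂ : Finset γ) (c₁ : Finset β) (c₂ : Finset γ),
      ∑ x : Finset β, ((refl (U xᶜ) ∩ F x ∩ G x).card + (U x ∩ refl (F xᶜ) ∩ G x).card + (U x ∩ F x ∩ refl (G xᶜ)).card)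
        ≤ translTerm U F G a₁ a₂ b₁ b₂ c₁ c₂ + 2 * ∑ x : Finset β, (U x ∩ F x ∩ G x).card

/-- The translates `a = (∅,∅)`, `b = (univ,univ)`, `c = (univ,∅)` give the positive term of `triWGen`:
`translTerm U F G ∅ ∅ univ univ univ ∅ = Σ_x #(U x ∩ refl (F xᶜ) ∩ G xᶜ)`. [this work] -/
theorem translTerm_triWGen (U F G : Finset β → Finset (Finset γ)) :
    translTerm U F G ∅ ∅ univ univ univ ∅ = ∑ x : Finset β, (U x ∩ refl (F xᶜ) ∩ G xᶜ).card := by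
  unfold translTerm
  refine sum_congr rfl fun x _ => ?_
  rw [transl_empty, transl_empty, transl_univ, symmDiff_empty_right, symmDiff_univ_eq_compl]

/-- **`TranslateIneq → TriWGenIneq`**: the three-family functional `triWGen U F G` is (SYM) at the translates `(∅,∅), (univ,univ), (univ,∅)`.
[this work] -/
theorem triWGenIneq_of_translateIneq (h : TranslateIneq) : TriWGenIneq := by
  intro β γ _ _ _ _ U F G hU hF hG hUm hFm hGm
  have key := h β γ U F G hU hF hG hUm hFm hGm ∅ ∅ univ univ univ ∅
  rw [translTerm_triWGen] at key
  set S1 := ∑ x : Finset β, (U x ∩ refl (F xᶜ) ∩ G xᶜ).card with hS1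
  set S0 := ∑ x : Finset β, (U x ∩ F x ∩ G x).card with hS0
  set S3 := ∑ x : Finset β, ((refl (U xᶜ) ∩ F x ∩ G x).card + (U x ∩ refl (F xᶜ) ∩ G x).card
      + (U x ∩ F x ∩ refl (G xᶜ)).card) with hS3
  have hsum : triWGen U F G = (S1 : ℤ) + 2 * (S0 : ℤ) - (S3 : ℤ) := by
    rw [hS1, hS0, hS3]
    unfold triWGen triWGenTerm
    push_cast
    rw [mul_sum, ← sum_add_distrib, ← sum_sub_distrib]
    refine sum_congr rfl fun x _ => ?_
    ring
  have key' : (S3 : ℤ) ≤ (S1 : ℤ) + 2 * (S0 : ℤ) := by exact_mod_cast key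
  rw [hsum]
  linarith

/-- **`TranslateIneq → TriWIneq`** (the crux target of `…SahiCombTriWGeneral`). [this work] -/
theorem triWIneq_of_translateIneq (h : TranslateIneq) : TriWIneq :=
  triWIneq_of_triWGenIneq (triWGenIneq_of_translateIneq h)

end FiveUpSet

end Summit.CriticalPhenomena.PercolationContinuityZ3.Theorems
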